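import Mathlib
import Summits.Ventures.HodgeRepro2.T5ContinuousCharacterBall

/-!
# T5ValuedBallBasis — the balls `{x | v x ≤ exp k}` are a neighbourhood basis of `0` in a
`Valued R ℤᵐ⁰` ring

Blind cell pub-hodge-repro2, seat p4 (Tier-5 Lean support, annex growth only).
Declaration per README §8(d): uses an L-value-free non-vanishing device: NO.

Mathlib's `Valued R Γ₀` describes the neighbourhood filter of `0` through the units of the
RESTRICTED value group `ValueGroup₀ (.ofClass v)` (`Valued.mem_nhds_zero`). For `Γ₀ = ℤᵐ⁰` this
file bridges that description to the closed balls `{x | v x ≤ exp k}` (`k : ℤ`) that the Tier-5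
prose uses (the additive groups `P_v^{-k}` of the conductor bookkeeping): every ball is a
neighbourhood of `0` (no hypothesis on `v` — in the trivial case the topology is discrete and the
balls still contain `0`), every neighbourhood of `0` contains a ball, hence the balls form a
neighbourhood basis of `0` (`hasBasis_nhds_zero_ball`); each ball is an open and closed additive
subgroup. Composed with `T5ContinuousCharacterBall` (p395437) this discharges the prose hypothesis
«the balls are a neighbourhood basis of `0`» of that file: a circle-valued additive character of a
`Valued K ℤᵐ⁰` field is continuous iff it is trivial on some ball
(`continuous_iff_exists_forall_le_exp_eq_one`).

Nothing here is asserted about the Tier-5 datum; the only inputs are Mathlib's `Valued` class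
and the accepted file p395437.
-/

namespace Summit.Ventures.HodgeRepro2.T5ValuedBallBasis

open WithZero Filter Topology

/-! ## §1 Discreteness of `ℤᵐ⁰`: `a < exp (k + 1) ↔ a ≤ exp k` -/

/-- In `ℤᵐ⁰` the strict ball of radius `exp (k + 1)` is the closed ball of radius `exp k`. -/
theorem lt_exp_succ_iff_le_exp (a : ℤᵐ⁰) (k : ℤ) : a < exp (k + 1) ↔ a ≤ exp k := by
  induction a with
  | zero => simp
  | coe m =>
    change exp (Multiplicative.toAdd m) < exp (k + 1) ↔ exp (Multiplicative.toAdd m) ≤ exp k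
    rw [WithZero.exp_lt_exp, WithZero.exp_le_exp]
    exact Int.lt_add_one_iff

/-- `exp n ≤ exp m` with `n ≤ -1` and `(N : ℤ) ≥ -m`: powers of a value `< 1` eventually lie
below any `exp m`. -/
theorem exp_pow_le_exp_of_le_neg_one {n m : ℤ} (hn : n ≤ -1) (N : ℕ) (hN : -m ≤ (N : ℤ)) :
    exp n ^ N ≤ exp m := by
  rw [← WithZero.exp_nsmul, WithZero.exp_le_exp, nsmul_eq_mul]
  nlinarith

/-! ## §2 The balls in a `Valued R ℤᵐ⁰` ring -/

section Ring

variable {R : Type*} [Ring R] [Valued R ℤᵐ⁰]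

/-- The closed ball `{x | v x ≤ exp k}` as the additive subgroup `v.leAddSubgroup (exp k)`. -/
theorem coe_leAddSubgroup_exp (k : ℤ) :
    ((Valued.v.leAddSubgroup (exp k) : AddSubgroup R) : Set R) = {x : R | Valued.v x ≤ exp k} :=
  rfl

/-- Every neighbourhood of `0` contains a closed ball `{x | v x ≤ exp k}`: the unit `γ` of the
restricted value group given by `Valued.mem_nhds_zero` embeds to a non-zero element
`exp (log γ)` of `ℤᵐ⁰`, and the ball of radius `exp (log γ - 1)` lies inside
`{x | v.restrict x < γ}`. -/
theorem exists_forall_le_exp_mem_of_mem_nhds_zero {s : Set R} (hs : s ∈ 𝓝 (0 : R)) :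
    ∃ k : ℤ, ∀ x : R, Valued.v x ≤ exp k → x ∈ s := by
  obtain ⟨γ, hγ⟩ := Valued.mem_nhds_zero.mp hs
  set e : (MonoidWithZeroHom.ofClass (Valued.v : Valuation R ℤᵐ⁰)).ValueGroup₀ →*₀ ℤᵐ⁰ :=
    MonoidWithZeroHom.ValueGroup₀.embedding with he
  have hne : e (Units.val γ) ≠ 0 := (map_ne_zero e).mpr γ.ne_zero
  refine ⟨WithZero.log (e (Units.val γ)) - 1, fun x hx => hγ ?_⟩
  show Valued.v.restrict x < Units.val γ
  rw [Valuation.restrict_lt_iff_lt_embedding]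
  calc Valued.v x ≤ exp (WithZero.log (e (Units.val γ)) - 1) := hx
    _ < exp (WithZero.log (e (Units.val γ))) := by
        rw [WithZero.exp_lt_exp]; exact sub_one_lt _
    _ = e (Units.val γ) := WithZero.exp_log hne

/-- Every closed ball `{x | v x ≤ exp k}` is a neighbourhood of `0`. If some `x₀` has
`0 < v x₀ < 1`, a power of the unit `v.restrict x₀` of the restricted value group gives a
strict ball inside the closed ball; otherwise `{x | v.restrict x < 1} = {x | v x = 0}` works. -/
theorem ball_mem_nhds_zero (k : ℤ) : {x : R | Valued.v x ≤ exp k} ∈ 𝓝 (0 : R) := by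
  rw [Valued.mem_nhds_zero]
  by_cases h : ∃ x₀ : R, 0 < Valued.v x₀ ∧ Valued.v x₀ < 1
  · obtain ⟨x₀, h0, h1⟩ := h
    have hne : Valued.v.restrict x₀ ≠ 0 := by
      rw [Ne, Valuation.restrict_eq_zero_iff]; exact h0.ne'
    have hlog : WithZero.log (Valued.v x₀) ≤ -1 := by
      have h1' : Valued.v x₀ < exp 0 := by rwa [WithZero.exp_zero]
      rw [← WithZero.exp_log h0.ne', WithZero.exp_lt_exp] at h1'
      omega
    refine ⟨Units.mk0 _ hne ^ (-k - 1).toNat, fun x hx => ?_⟩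
    rw [Set.mem_setOf_eq, Valuation.restrict_lt_iff_lt_embedding, Units.val_pow_eq_pow_val,
      map_pow, Units.val_mk0, Valuation.embedding_restrict] at hx
    have hpow : Valued.v x₀ ^ (-k - 1).toNat ≤ exp (k + 1) := by
      rw [← WithZero.exp_log h0.ne']
      exact exp_pow_le_exp_of_le_neg_one hlog _ (by
        have := Int.self_le_toNat (-k - 1); omega)
    show Valued.v x ≤ exp k
    exact (lt_exp_succ_iff_le_exp _ _).mp (hx.trans_le hpow)
  · have h' : ∀ x₀ : R, 0 < Valued.v x₀ → 1 ≤ Valued.v x₀ :=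
      fun x₀ h0 => le_of_not_gt fun h1 => h ⟨x₀, h0, h1⟩
    refine ⟨1, fun x hx => ?_⟩
    have hx1 : Valued.v x < 1 := (Valuation.restrict_lt_one_iff _).mp hx
    have hx0 : Valued.v x = 0 := by
      by_contra hne
      exact absurd (h' x (zero_lt_iff.mpr hne)) (not_le.mpr hx1)
    show Valued.v x ≤ exp k
    rw [hx0]; exact zero_le

/-- The closed balls `{x | v x ≤ exp k}`, `k : ℤ`, form a neighbourhood basis of `0`. -/
theorem hasBasis_nhds_zero_ball :
    (𝓝 (0 : R)).HasBasis (fun _ : ℤ => True) (fun k => {x : R | Valued.v x ≤ exp k}) := by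
  refine Filter.hasBasis_iff.mpr fun s => ⟨fun hs => ?_, ?_⟩
  · obtain ⟨k, hk⟩ := exists_forall_le_exp_mem_of_mem_nhds_zero hs
    exact ⟨k, trivial, fun x hx => hk x hx⟩
  · rintro ⟨k, -, hk⟩
    exact Filter.mem_of_superset (ball_mem_nhds_zero k) hk

/-- The hypothesis form used by `T5ContinuousCharacterBall`: every neighbourhood of `0`
contains a ball. -/
theorem forall_mem_nhds_zero_exists_forall_le_exp_mem :
    ∀ s ∈ 𝓝 (0 : R), ∃ k : ℤ, ∀ x : R, Valued.v x ≤ exp k → x ∈ s :=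
  fun _ hs => exists_forall_le_exp_mem_of_mem_nhds_zero hs

/-- Each closed ball is open (an additive subgroup that is a neighbourhood of `0`). -/
theorem isOpen_ball (k : ℤ) : IsOpen {x : R | Valued.v x ≤ exp k} :=
  (Valued.v.leAddSubgroup (exp k)).isOpen_of_mem_nhds (g := 0) (ball_mem_nhds_zero k)

/-- Each closed ball is closed (an open additive subgroup is closed). -/
theorem isClosed_ball (k : ℤ) : IsClosed {x : R | Valued.v x ≤ exp k} :=
  (Valued.v.leAddSubgroup (exp k)).isClosed_of_isOpen (isOpen_ball k)

/-- The strict ball of radius `exp (k + 1)` is the closed ball of radius `exp k`. -/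
theorem setOf_lt_exp_succ_eq (k : ℤ) :
    {x : R | Valued.v x < exp (k + 1)} = {x : R | Valued.v x ≤ exp k} :=
  Set.ext fun x => lt_exp_succ_iff_le_exp (Valued.v x) k

end Ring

/-! ## §3 Composition with `T5ContinuousCharacterBall` (p395437): continuity of additive
characters of a `Valued K ℤᵐ⁰` field ⟺ triviality on a ball -/

section Field

variable {K : Type*} [Field K] [Valued K ℤᵐ⁰]

/-- A circle-valued additive character continuous at `0` is trivial on some ball
`{x | v x ≤ exp k}` — p395437's theorem with its neighbourhood-basis hypothesis discharged. -/
theorem exists_forall_le_exp_eq_one_of_continuousAt (ψ : AddChar K Circle)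
    (hψ : ContinuousAt ψ 0) : ∃ k : ℤ, ∀ x : K, Valued.v x ≤ exp k → ψ x = 1 :=
  T5ContinuousCharacterBall.exists_forall_le_exp_eq_one_of_continuousAt Valued.v ψ hψ
    forall_mem_nhds_zero_exists_forall_le_exp_mem

/-- A continuous circle-valued additive character is trivial on some ball. -/
theorem exists_forall_le_exp_eq_one_of_continuous (ψ : AddChar K Circle) (hψ : Continuous ψ) :
    ∃ k : ℤ, ∀ x : K, Valued.v x ≤ exp k → ψ x = 1 :=
  T5ContinuousCharacterBall.exists_forall_le_exp_eq_one_of_continuous Valued.v ψ hψ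
    forall_mem_nhds_zero_exists_forall_le_exp_mem

/-- An additive character (any topological target monoid) trivial on a ball is continuous. -/
theorem continuous_of_forall_le_exp_eq_one {M : Type*} [Monoid M] [TopologicalSpace M]
    (ψ : AddChar K M) (k : ℤ) (h : ∀ x : K, Valued.v x ≤ exp k → ψ x = 1) : Continuous ψ :=
  T5ContinuousCharacterBall.continuous_of_forall_le_exp_eq_one Valued.v ψ k h
    (ball_mem_nhds_zero k)

/-- A circle-valued additive character of a `Valued K ℤᵐ⁰` field is continuous iff it is
trivial on some ball `{x | v x ≤ exp k}`. -/
theorem continuous_iff_exists_forall_le_exp_eq_one (ψ : AddChar K Circle) :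
    Continuous ψ ↔ ∃ k : ℤ, ∀ x : K, Valued.v x ≤ exp k → ψ x = 1 :=
  ⟨exists_forall_le_exp_eq_one_of_continuous ψ, fun ⟨k, hk⟩ =>
    continuous_of_forall_le_exp_eq_one ψ k hk⟩

/-- Continuity at `0` of a circle-valued additive character already gives continuity. -/
theorem continuous_of_continuousAt_zero (ψ : AddChar K Circle) (hψ : ContinuousAt ψ 0) :
    Continuous ψ :=
  let ⟨k, hk⟩ := exists_forall_le_exp_eq_one_of_continuousAt ψ hψ
  continuous_of_forall_le_exp_eq_one ψ k hk

end Field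

end Summit.Ventures.HodgeRepro2.T5ValuedBallBasis
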